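import Summits.Ventures.LatticeQCDFlow.Exactness.ReversibleMixture
import Summits.Ventures.LatticeQCDFlow.Exactness.ReversibleVariationalSupTauInt
import HarnessLib

/-!
# A random mixture of ANY finitely many exact reversible updates is never worse than the HARMONIC MEAN of its components: `τ_M(g) + ½ ≤ 1/Σᵢ αᵢ/(τᵢ(g) + ½)`, observable by observable

HONEST FRAMING: exact (Metropolis-corrected) sampling algorithms for lattice gauge theory;
figures of merit are autocorrelation/cost numbers at stated couplings and volumes; no
continuum-physics claim.  (SCALAR calibration rung S0-A: not a gauge result.)

Venture `LatticeQCDFlow` (cell pub-lqcd), topic `Exactness`; FANOUT row 2 (`s0-phi4`).  NEW WORK of the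
cell in the `RevOp` format (general s-finite space, an admissible class `A`, reversible contractions —
the flow arm, the HMC arm, the local Metropolis arm, a heat bath, …; NO positivity is used), sharpening
the tree's two-component `Exactness/ReversibleMixture` (`τ_M + ½ ≤ (τ₁ + ½)/a`: the best component
over its weight) to ANY finite number of components and to the weighted HARMONIC MEAN:

  `M f = Σᵢ αᵢ Kᵢ f` (`αᵢ > 0`, `Σ αᵢ = 1`; "toss an `α`-die at every update"), `g ∈ A`, `C_g(0) > 0`,
  normalised series summable under `M` and under each `Kᵢ`, `i ∈ S` (any nonempty `S`) ⇒
  **`τ_M(g) + ½ ≤ 1 / Σ_{i ∈ S} αᵢ/(τᵢ(g) + ½)`**.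

With `S = {i}` this is the tree's weight bound; with all components it is the harmonic mean, hence at
most the arithmetic mean.  Mechanism (format level, no spectral theorem): `𝓔_M = Σ αᵢ 𝓔ᵢ`; each
summable component's sharp variational inequality `(∫ g v w)² ≤ P Tᵢ 𝓔ᵢ(v)`
(`RevOp.sq_inner_le_tsum_mul_dirichlet`, `Tᵢ = τᵢ + ½`) divided by `Tᵢ` and summed gives the variational
bound for `M` with constant `P/Σ αᵢ/Tᵢ`, and `RevOp.tsum_le_of_forall_sq_inner_le_dirichlet` closes.
The finite-state form (Kemeny–Snell `asympVar`, no summability hypotheses) is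
`ReversibleKernelMixtureHarmonicMean`; the proposal-mixture form for flows is
`FlowSamplerMixtureHarmonicMean`.  Printed counterparts NAMED ONLY: hybrid kernel mixtures (Tierney
1994 §2.4); the operator-convexity of `A ↦ A⁻¹`.  Nothing is cited as a fact.

## What is proved (namespace `RevOp`)

* `mixN_mem`, `mixN_add_mul`, `mixN_symm`, `mixN_contr` — `M` is again in the format (stab / lin / symm / contr; `sq_finWeightedAvg_le`);
  **`dirichlet_mixN_eq`** — `𝓔_M(v) = Σ αᵢ 𝓔ᵢ(v)`;
* **`tauInt_mixN_add_half_le_harmonicMean`** — THE THEOREM; `tauInt_mixN_add_half_le_single` — the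
  one-component form `τ_M + ½ ≤ (τᵢ + ½)/αᵢ` for any finite mixture.

NOT CLAIMED: a lower bound (a mixture can beat all components); deterministic cycles `K₁K₂⋯`
(not reversible); cost accounting (the components may have different prices per update); any number
for any run.
-/

namespace Summit.Ventures.LatticeQCDFlow.Exactness

open Real MeasureTheory Filter Finset Topology
open Summit.Ventures.LatticeQCDFlow.Scoring

namespace RevOp

variable {X : Type*} [MeasurableSpace X] {μ : Measure X} {w : X → ℝ} {A : (X → ℝ) → Prop}
  {ι : Type*} [Fintype ι] {K : ι → (X → ℝ) → (X → ℝ)} {M : (X → ℝ) → (X → ℝ)} {α : ι → ℝ}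

/-! ## §1 The `N`-component mixture is again in the format -/

omit [MeasurableSpace X] [Fintype ι] in
/-- Finite weighted sums of admissible images stay admissible. -/
theorem finsetSum_mem (hAc : ∀ ⦃f h : X → ℝ⦄ (c : ℝ), A f → A h → A (fun x => f x + c * h x))
    (hAK : ∀ i ⦃f : X → ℝ⦄, A f → A (K i f)) {f : X → ℝ} (hf : A f) (s : Finset ι) :
    A (fun x => ∑ i ∈ s, α i * K i f x) := by
  classical
  induction s using Finset.induction_on with
  | empty =>
    have h := hAc (-1) hf hf
    have e : (fun x => f x + (-1) * f x) = fun x => ∑ i ∈ (∅ : Finset ι), α i * K i f x :=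
      funext fun x => by simp
    rw [e] at h
    exact h
  | insert j s hj ih =>
    have h := hAc (α j) ih (hAK j hf)
    have e : (fun x => (∑ i ∈ s, α i * K i f x) + α j * K j f x)
        = fun x => ∑ i ∈ insert j s, α i * K i f x :=
      funext fun x => by rw [Finset.sum_insert hj, add_comm]
    rw [e] at h
    exact h

omit [MeasurableSpace X] in
/-- **(stab)**: `A f → A (M f)` for `M f = Σ αᵢ Kᵢ f`. -/
theorem mixN_mem (hAc : ∀ ⦃f h : X → ℝ⦄ (c : ℝ), A f → A h → A (fun x => f x + c * h x))
    (hAK : ∀ i ⦃f : X → ℝ⦄, A f → A (K i f)) (hM : ∀ f x, M f x = ∑ i, α i * K i f x)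
    {f : X → ℝ} (hf : A f) : A (M f) := by
  have e : M f = fun x => ∑ i, α i * K i f x := funext (hM f)
  rw [e]
  exact finsetSum_mem hAc hAK hf Finset.univ

omit [MeasurableSpace X] in
/-- **(lin)** for the mixture. -/
theorem mixN_add_mul
    (hlin : ∀ i ⦃f h : X → ℝ⦄ (c : ℝ), A f → A h →
      ∀ x, K i (fun s => f s + c * h s) x = K i f x + c * K i h x)
    (hM : ∀ f x, M f x = ∑ i, α i * K i f x)
    {f h : X → ℝ} (c : ℝ) (hf : A f) (hh : A h) (x : X) :
    M (fun s => f s + c * h s) x = M f x + c * M h x := by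
  rw [hM, hM, hM, Finset.mul_sum, ← Finset.sum_add_distrib]
  exact Finset.sum_congr rfl fun i _ => by rw [hlin i c hf hh x]; ring

/-- **(symm)** for the mixture. -/
theorem mixN_symm (hAi : ∀ ⦃f h : X → ℝ⦄, A f → A h → Integrable (fun x => f x * h x * w x) μ)
    (hAK : ∀ i ⦃f : X → ℝ⦄, A f → A (K i f))
    (hsymm : ∀ i ⦃f h : X → ℝ⦄, A f → A h →
      ∫ x, K i f x * h x * w x ∂μ = ∫ x, f x * K i h x * w x ∂μ)
    (hM : ∀ f x, M f x = ∑ i, α i * K i f x) {f h : X → ℝ} (hf : A f) (hh : A h) :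
    ∫ x, M f x * h x * w x ∂μ = ∫ x, f x * M h x * w x ∂μ := by
  simp only [hM]
  have i1 : ∀ i, Integrable (fun x => α i * (K i f x * h x * w x)) μ :=
    fun i => (hAi (hAK i hf) hh).const_mul _
  have i2 : ∀ i, Integrable (fun x => α i * (f x * K i h x * w x)) μ :=
    fun i => (hAi hf (hAK i hh)).const_mul _
  have e1 : ∀ x, (∑ i, α i * K i f x) * h x * w x = ∑ i, α i * (K i f x * h x * w x) := fun x => by
    rw [Finset.sum_mul, Finset.sum_mul]
    exact Finset.sum_congr rfl fun i _ => by ring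
  have e2 : ∀ x, f x * (∑ i, α i * K i h x) * w x = ∑ i, α i * (f x * K i h x * w x) := fun x => by
    rw [Finset.mul_sum, Finset.sum_mul]
    exact Finset.sum_congr rfl fun i _ => by ring
  simp_rw [e1, e2]
  rw [integral_finsetSum Finset.univ fun i _ => i1 i, integral_finsetSum Finset.univ fun i _ => i2 i]
  refine Finset.sum_congr rfl fun i _ => ?_
  rw [integral_const_mul, integral_const_mul, hsymm i hf hh]

omit [MeasurableSpace X] in
/-- Weighted Jensen for the square: `αᵢ ≥ 0`, `Σ αᵢ = 1` ⇒ `(Σ αᵢ yᵢ)² ≤ Σ αᵢ yᵢ²`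
(`Σ αᵢ (yᵢ − m)² ≥ 0`, `m = Σ αᵢ yᵢ`). -/
theorem sq_finWeightedAvg_le (hα : ∀ i, 0 ≤ α i) (hα1 : ∑ i, α i = 1) (y : ι → ℝ) :
    (∑ i, α i * y i) ^ 2 ≤ ∑ i, α i * y i ^ 2 := by
  set m := ∑ i, α i * y i with hm
  have h0 : 0 ≤ ∑ i, α i * (y i - m) ^ 2 := Finset.sum_nonneg fun i _ => mul_nonneg (hα i) (sq_nonneg _)
  have e : ∑ i, α i * (y i - m) ^ 2 = (∑ i, α i * y i ^ 2) - 2 * m * (∑ i, α i * y i) + m ^ 2 * ∑ i, α i := by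
    have : ∀ i, α i * (y i - m) ^ 2 = α i * y i ^ 2 - 2 * m * (α i * y i) + m ^ 2 * α i := fun i => by ring
    simp only [this, Finset.sum_add_distrib, Finset.sum_sub_distrib, ← Finset.mul_sum]
  rw [e, ← hm, hα1] at h0
  nlinarith

/-- **(contr)** for the mixture (`αᵢ ≥ 0`, `Σ αᵢ = 1`): convexity of the square. -/
theorem mixN_contr (hw0 : ∀ x, 0 ≤ w x)
    (hAi : ∀ ⦃f h : X → ℝ⦄, A f → A h → Integrable (fun x => f x * h x * w x) μ)
    (hAc : ∀ ⦃f h : X → ℝ⦄ (c : ℝ), A f → A h → A (fun x => f x + c * h x))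
    (hAK : ∀ i ⦃f : X → ℝ⦄, A f → A (K i f))
    (hcontr : ∀ i ⦃f : X → ℝ⦄, A f → ∫ x, K i f x ^ 2 * w x ∂μ ≤ ∫ x, f x ^ 2 * w x ∂μ)
    (hM : ∀ f x, M f x = ∑ i, α i * K i f x) (hα : ∀ i, 0 ≤ α i) (hα1 : ∑ i, α i = 1)
    {f : X → ℝ} (hf : A f) : ∫ x, M f x ^ 2 * w x ∂μ ≤ ∫ x, f x ^ 2 * w x ∂μ := by
  have iM : Integrable (fun x => M f x ^ 2 * w x) μ := integrable_sq_mul hAi (mixN_mem hAc hAK hM hf)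
  have iK : ∀ i, Integrable (fun x => K i f x ^ 2 * w x) μ := fun i => integrable_sq_mul hAi (hAK i hf)
  have hmono : ∫ x, M f x ^ 2 * w x ∂μ ≤ ∫ x, ∑ i, α i * (K i f x ^ 2 * w x) ∂μ := by
    refine integral_mono iM (integrable_finsetSum Finset.univ fun i _ => (iK i).const_mul _) fun x => ?_
    show M f x ^ 2 * w x ≤ ∑ i, α i * (K i f x ^ 2 * w x)
    rw [hM]
    have h := sq_finWeightedAvg_le (ι := ι) hα hα1 (fun i => K i f x)
    calc (∑ i, α i * K i f x) ^ 2 * w x ≤ (∑ i, α i * K i f x ^ 2) * w x :=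
          mul_le_mul_of_nonneg_right h (hw0 x)
      _ = ∑ i, α i * (K i f x ^ 2 * w x) := by
          rw [Finset.sum_mul]; exact Finset.sum_congr rfl fun i _ => by ring
  refine hmono.trans ?_
  rw [integral_finsetSum Finset.univ fun i _ => (iK i).const_mul _]
  simp only [integral_const_mul]
  calc ∑ i, α i * ∫ x, K i f x ^ 2 * w x ∂μ ≤ ∑ i, α i * ∫ x, f x ^ 2 * w x ∂μ :=
        Finset.sum_le_sum fun i _ => mul_le_mul_of_nonneg_left (hcontr i hf) (hα i)
    _ = ∫ x, f x ^ 2 * w x ∂μ := by rw [← Finset.sum_mul, hα1, one_mul]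

/-! ## §2 The Dirichlet form of the mixture -/

/-- **`𝓔_M(v) = Σ αᵢ 𝓔ᵢ(v)`** (`Σ αᵢ = 1`). -/
theorem dirichlet_mixN_eq (hAi : ∀ ⦃f h : X → ℝ⦄, A f → A h → Integrable (fun x => f x * h x * w x) μ)
    (hAK : ∀ i ⦃f : X → ℝ⦄, A f → A (K i f)) (hM : ∀ f x, M f x = ∑ i, α i * K i f x)
    (hα1 : ∑ i, α i = 1) {v : X → ℝ} (hv : A v) :
    (∫ x, v x ^ 2 * w x ∂μ) - ∫ x, v x * M v x * w x ∂μ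
      = ∑ i, α i * ((∫ x, v x ^ 2 * w x ∂μ) - ∫ x, v x * K i v x * w x ∂μ) := by
  simp only [hM]
  have i1 : ∀ i, Integrable (fun x => α i * (v x * K i v x * w x)) μ :=
    fun i => (hAi hv (hAK i hv)).const_mul _
  have e : ∀ x, v x * (∑ i, α i * K i v x) * w x = ∑ i, α i * (v x * K i v x * w x) := fun x => by
    rw [Finset.mul_sum, Finset.sum_mul]
    exact Finset.sum_congr rfl fun i _ => by ring
  simp_rw [e]
  rw [integral_finsetSum Finset.univ fun i _ => i1 i]
  simp only [integral_const_mul, mul_sub, Finset.sum_sub_distrib]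
  rw [← Finset.sum_mul, hα1, one_mul]

/-! ## §3 The harmonic-mean bound -/

/-- **A RANDOM MIXTURE OF EXACT REVERSIBLE UPDATES IS NEVER WORSE THAN THE HARMONIC MEAN OF ANY SET OF
ITS SUMMABLE COMPONENTS.**  `Kᵢ` reversible contractions on the class `A` (stab / lin / symm / contr),
`M f = Σ αᵢ Kᵢ f` with `αᵢ > 0`, `Σ αᵢ = 1`; `g ∈ A`, `∫ g² w > 0`; the normalised autocorrelation series
of `g` summable under `M` and under `Kᵢ` for every `i ∈ S` (`S` nonempty; `τᵢ` the `τ_int` under `Kᵢ`).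
Then `τ_M(g) + ½ ≤ 1 / Σ_{i ∈ S} αᵢ/(τᵢ(g) + ½)`. -/
theorem tauInt_mixN_add_half_le_harmonicMean (hw0 : ∀ x, 0 ≤ w x)
    (hAi : ∀ ⦃f h : X → ℝ⦄, A f → A h → Integrable (fun x => f x * h x * w x) μ)
    (hAc : ∀ ⦃f h : X → ℝ⦄ (c : ℝ), A f → A h → A (fun x => f x + c * h x))
    (hAK : ∀ i ⦃f : X → ℝ⦄, A f → A (K i f))
    (hlin : ∀ i ⦃f h : X → ℝ⦄ (c : ℝ), A f → A h →
      ∀ x, K i (fun s => f s + c * h s) x = K i f x + c * K i h x)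
    (hsymm : ∀ i ⦃f h : X → ℝ⦄, A f → A h →
      ∫ x, K i f x * h x * w x ∂μ = ∫ x, f x * K i h x * w x ∂μ)
    (hcontr : ∀ i ⦃f : X → ℝ⦄, A f → ∫ x, K i f x ^ 2 * w x ∂μ ≤ ∫ x, f x ^ 2 * w x ∂μ)
    (hM : ∀ f x, M f x = ∑ i, α i * K i f x) (hα : ∀ i, 0 < α i) (hα1 : ∑ i, α i = 1)
    {g : X → ℝ} (hg : A g) (hP : 0 < ∫ x, g x ^ 2 * w x ∂μ) {S : Finset ι} (hS : S.Nonempty)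
    (hs : ∀ i ∈ S, Summable fun n => (∫ x, g x * ((K i)^[n + 1] g) x * w x ∂μ) / ∫ x, g x ^ 2 * w x ∂μ)
    (hsM : Summable fun n => (∫ x, g x * (M^[n + 1] g) x * w x ∂μ) / ∫ x, g x ^ 2 * w x ∂μ) :
    tauInt (fun n => (∫ x, g x * (M^[n] g) x * w x ∂μ) / ∫ x, g x ^ 2 * w x ∂μ) + 1 / 2
      ≤ 1 / ∑ i ∈ S, α i / (tauInt (fun n => (∫ x, g x * ((K i)^[n] g) x * w x ∂μ)
          / ∫ x, g x ^ 2 * w x ∂μ) + 1 / 2) := by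
  set P := ∫ x, g x ^ 2 * w x ∂μ with hPdef
  set C : ι → ℕ → ℝ := fun i k => ∫ x, g x * ((K i)^[k] g) x * w x ∂μ with hC
  set CM : ℕ → ℝ := fun k => ∫ x, g x * (M^[k] g) x * w x ∂μ with hCM
  set T : ι → ℝ := fun i => ∑' k, C i k / P with hT
  -- the mixture's format facts
  have hMmem : ∀ ⦃f : X → ℝ⦄, A f → A (M f) := fun _ hf => mixN_mem hAc hAK hM hf
  have hMlin : ∀ ⦃f h : X → ℝ⦄ (c : ℝ), A f → A h →
      ∀ x, M (fun s => f s + c * h s) x = M f x + c * M h x :=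
    fun _ _ c hf hh x => mixN_add_mul hlin hM c hf hh x
  have hMsymm : ∀ ⦃f h : X → ℝ⦄, A f → A h →
      ∫ x, M f x * h x * w x ∂μ = ∫ x, f x * M h x * w x ∂μ :=
    fun _ _ hf hh => mixN_symm hAi hAK hsymm hM hf hh
  -- `C i 0 = CM 0 = P`
  have hC0 : ∀ i, C i 0 / P = 1 := fun i => by
    have e : C i 0 = P := by
      simp only [hC, hPdef, Function.iterate_zero, id_eq]
      exact integral_congr_ae (Eventually.of_forall fun x => by ring)
    rw [e, div_self hP.ne']
  have hsum0 : ∀ i ∈ S, Summable fun k => C i k / P := fun i hi => (summable_nat_add_iff 1).1 (hs i hi)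
  have hTi : ∀ i, T i = ∑' k, C i k / P := fun i => rfl
  have hTeq : ∀ i ∈ S, T i = tauInt (fun n => C i n / P) + 1 / 2 := fun i hi => by
    rw [hTi, (hsum0 i hi).tsum_eq_zero_add, hC0]
    unfold tauInt
    ring
  -- `Tᵢ > 0` on `S`: the series `Σ_k ρᵢ(k)` dominates a variational ratio at `v = g`
  have hTpos : ∀ i ∈ S, 0 < T i := fun i hi => by
    have h2 := sq_inner_le_tsum_mul_dirichlet hw0 hAi hAc (hAK i) (hlin i) (hsymm i) (hcontr i)
      hg hg (hs i hi)
    have hgg : ∫ x, g x * g x * w x ∂μ = P := integral_congr_ae (Eventually.of_forall fun x => by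
      show g x * g x * w x = g x ^ 2 * w x; ring)
    have hX : (∑' k, (∫ x, g x * ((K i)^[k] g) x * w x ∂μ) / ∫ x, g x ^ 2 * w x ∂μ) = T i := rfl
    rw [hgg, hX, ← hPdef] at h2
    have hE0 : 0 ≤ P - ∫ x, g x * K i g x * w x ∂μ := by
      have := quadForm_nonneg hw0 hAi (hAK i) (hcontr i) hg zero_le_one le_rfl
      rw [one_mul] at this
      exact this
    by_contra hle
    have hT0 : T i ≤ 0 := le_of_not_gt hle
    have hneg : P * (T i * (P - ∫ x, g x * K i g x * w x ∂μ)) ≤ 0 :=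
      mul_nonpos_of_nonneg_of_nonpos hP.le (mul_nonpos_of_nonpos_of_nonneg hT0 hE0)
    nlinarith [h2, hneg, hP]
  set H := ∑ i ∈ S, α i / T i with hH
  have hHpos : 0 < H := Finset.sum_pos (fun i hi => div_pos (hα i) (hTpos i hi)) hS
  -- the variational bound for `M` with constant `P/H`
  have hvar : ∀ ⦃v : X → ℝ⦄, A v → (∫ x, g x * v x * w x ∂μ) ^ 2
      ≤ P / H * ((∫ x, v x ^ 2 * w x ∂μ) - ∫ x, v x * M v x * w x ∂μ) := by
    intro v hv
    set Bv := ∫ x, g x * v x * w x ∂μ with hBv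
    set E : ι → ℝ := fun i => (∫ x, v x ^ 2 * w x ∂μ) - ∫ x, v x * K i v x * w x ∂μ with hE
    have hE0 : ∀ i, 0 ≤ E i := fun i => by
      have := quadForm_nonneg hw0 hAi (hAK i) (hcontr i) hv zero_le_one le_rfl
      rw [one_mul] at this
      exact this
    have hi : ∀ i ∈ S, Bv ^ 2 * (α i / T i) ≤ P * (α i * E i) := fun i hiS => by
      have h2 := sq_inner_le_tsum_mul_dirichlet hw0 hAi hAc (hAK i) (hlin i) (hsymm i) (hcontr i)
        hg hv (hs i hiS)
      have h3 : Bv ^ 2 / T i ≤ P * E i := by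
        rw [div_le_iff₀ (hTpos i hiS)]
        calc Bv ^ 2 ≤ P * (T i * E i) := h2
          _ = P * E i * T i := by ring
      calc Bv ^ 2 * (α i / T i) = α i * (Bv ^ 2 / T i) := by ring
        _ ≤ α i * (P * E i) := mul_le_mul_of_nonneg_left h3 (hα i).le
        _ = P * (α i * E i) := by ring
    have hsumS : Bv ^ 2 * H ≤ P * ∑ i ∈ S, α i * E i := by
      rw [hH, Finset.mul_sum, Finset.mul_sum]
      exact Finset.sum_le_sum fun i hiS => hi i hiS
    have hSU : ∑ i ∈ S, α i * E i ≤ ∑ i, α i * E i :=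
      Finset.sum_le_univ_sum_of_nonneg fun i => mul_nonneg (hα i).le (hE0 i)
    have hdir := dirichlet_mixN_eq hAi hAK hM hα1 hv
    calc Bv ^ 2 = Bv ^ 2 * H / H := by field_simp
      _ ≤ P * (∑ i ∈ S, α i * E i) / H := div_le_div_of_nonneg_right hsumS hHpos.le
      _ ≤ P * (∑ i, α i * E i) / H :=
          div_le_div_of_nonneg_right (mul_le_mul_of_nonneg_left hSU hP.le) hHpos.le
      _ = P / H * ((∫ x, v x ^ 2 * w x ∂μ) - ∫ x, v x * M v x * w x ∂μ) := by rw [hdir]; ring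
  -- `Σ' C_M ≤ P/H`
  have hsCM : Summable fun k => CM k := by
    have hsρ : Summable fun k => CM k / P := (summable_nat_add_iff 1).1 hsM
    refine (hsρ.mul_left P).congr fun k => ?_
    field_simp
  have hmain := tsum_le_of_forall_sq_inner_le_dirichlet hAi hAc hMmem hMlin hMsymm hg hsCM
    (div_pos hP hHpos).le hvar
  -- `Σ' C_M = P (τ_M + ½)`
  have hCM0 : CM 0 = P := by
    simp only [hCM, hPdef, Function.iterate_zero, id_eq]
    exact integral_congr_ae (Eventually.of_forall fun x => by ring)
  have hsρM : Summable fun k => CM k / P := (summable_nat_add_iff 1).1 hsM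
  have hτM : tauInt (fun n => CM n / P) + 1 / 2 = (∑' k, CM k) / P := by
    have h1 : ∑' k, CM k / P = tauInt (fun n => CM n / P) + 1 / 2 := by
      rw [hsρM.tsum_eq_zero_add, hCM0, div_self hP.ne']
      unfold tauInt
      ring
    rw [← h1, tsum_div_const]
  rw [hτM, div_le_iff₀ hP]
  have eH : ∑ i ∈ S, α i / (tauInt (fun n => C i n / P) + 1 / 2) = H := by
    rw [hH]
    exact Finset.sum_congr rfl fun i hi => by rw [hTeq i hi]
  rw [eH]
  calc ∑' k, CM k ≤ P / H := hmain
    _ = 1 / H * P := by ring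

/-- **ONE GOOD COMPONENT: `τ_M(g) + ½ ≤ (τᵢ(g) + ½)/αᵢ`** for any finite mixture (the tree's
two-component weight bound, now for `N` components). -/
theorem tauInt_mixN_add_half_le_single (hw0 : ∀ x, 0 ≤ w x)
    (hAi : ∀ ⦃f h : X → ℝ⦄, A f → A h → Integrable (fun x => f x * h x * w x) μ)
    (hAc : ∀ ⦃f h : X → ℝ⦄ (c : ℝ), A f → A h → A (fun x => f x + c * h x))
    (hAK : ∀ i ⦃f : X → ℝ⦄, A f → A (K i f))
    (hlin : ∀ i ⦃f h : X → ℝ⦄ (c : ℝ), A f → A h →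
      ∀ x, K i (fun s => f s + c * h s) x = K i f x + c * K i h x)
    (hsymm : ∀ i ⦃f h : X → ℝ⦄, A f → A h →
      ∫ x, K i f x * h x * w x ∂μ = ∫ x, f x * K i h x * w x ∂μ)
    (hcontr : ∀ i ⦃f : X → ℝ⦄, A f → ∫ x, K i f x ^ 2 * w x ∂μ ≤ ∫ x, f x ^ 2 * w x ∂μ)
    (hM : ∀ f x, M f x = ∑ i, α i * K i f x) (hα : ∀ i, 0 < α i) (hα1 : ∑ i, α i = 1)
    {g : X → ℝ} (hg : A g) (hP : 0 < ∫ x, g x ^ 2 * w x ∂μ) (i : ι)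
    (hs : Summable fun n => (∫ x, g x * ((K i)^[n + 1] g) x * w x ∂μ) / ∫ x, g x ^ 2 * w x ∂μ)
    (hsM : Summable fun n => (∫ x, g x * (M^[n + 1] g) x * w x ∂μ) / ∫ x, g x ^ 2 * w x ∂μ) :
    tauInt (fun n => (∫ x, g x * (M^[n] g) x * w x ∂μ) / ∫ x, g x ^ 2 * w x ∂μ) + 1 / 2
      ≤ (tauInt (fun n => (∫ x, g x * ((K i)^[n] g) x * w x ∂μ) / ∫ x, g x ^ 2 * w x ∂μ) + 1 / 2)
        / α i := by
  have h := tauInt_mixN_add_half_le_harmonicMean hw0 hAi hAc hAK hlin hsymm hcontr hM hα hα1 hg hP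
    (Finset.singleton_nonempty i) (fun j hj => by rw [Finset.mem_singleton.1 hj]; exact hs) hsM
  rw [Finset.sum_singleton, one_div_div] at h
  exact h

end RevOp

end Summit.Ventures.LatticeQCDFlow.Exactness
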